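import Mathlib
import Summits.ResolutionOfSingularities.ResolutionOfSingularities.Theorems.RadicialJungCleanModelsCleanPatchingDefs
import Literature.AlgebraicGeometry.Motives.CartierDivisor
import HarnessLib

/-!
# Route `RadicialJung`, crux `CleanModels` (stmt-ResolutionOfSingularities-15917), line `Sketch` rev 14:
# transport of the clean-regularity predicates

Shared infrastructure for the registered stubs 4a–4e of `Cruxes/CleanModels/Lines/Sketch.lean` rev 14 (Zariski patching for
clean pairs): the predicates `LooseCleanForm p f X` / `CleanRegAt p f g₀` of `RadicialJungCleanModelsCleanPatchingDefs.lean`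
(a local ring `R` read in a field through `f : R → F`) are moved

* along a ring isomorphism `e : R ≃+* R'` compatible with the readings (`LooseCleanForm.of_ringEquiv`,
  `CleanRegAt.of_ringEquiv`);
* along an injective ring map of the target `ι : F → F'` (`LooseCleanForm.map`, `CleanRegAt.map`) and back along a
  bijective one (`CleanRegAt.of_map_ringEquiv`, `cleanRegAt_map_ringEquiv_iff`);
* along a dominant morphism of integral schemes which is a local isomorphism at the point
  (`CleanRegAt.functionFieldMap_of_isIso_stalkMap`; with `RatFn.functionFieldMap`), and back when the morphism is
  birational on function fields (`cleanRegAt_functionFieldMap_iff_of_bijective`);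
* between the two currencies of a projective model `M : ProjModel k K` — the local ring `M.stalkSubring x ⊆ K`
  (`ModelCleanRegAt`) and the stalk `𝒪_{M,x}` read in `K(M)` (`modelCleanRegAt_iff_stalk`).

All PROVED (bookkeeping only); nothing here proves resolution in characteristic `p` or any case of `CleanModels`.
-/

noncomputable section

set_option linter.dupNamespace false -- mandated namespace of this single-conjunct summit

open CategoryTheory AlgebraicGeometry IsLocalRing
open Literature.AlgebraicGeometry.Resolution Literature.AlgebraicGeometry.Motives

namespace Summit.ResolutionOfSingularities.ResolutionOfSingularities.Theorems.RadicialJung.CleanModels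

variable {p : ℕ}

/-! ## Along ring isomorphisms of the local ring -/

section RingEquiv

variable {R R' F : Type*} [CommRing R] [CommRing R'] [CommRing F]

/-- A ring isomorphism of local rings maps the maximal ideal onto the maximal ideal. [folklore] -/
theorem mem_maximalIdeal_ringEquiv_iff [IsLocalRing R] [IsLocalRing R'] (e : R ≃+* R') (x : R) :
    e x ∈ maximalIdeal R' ↔ x ∈ maximalIdeal R := by
  simp only [mem_maximalIdeal, mem_nonunits_iff, MulEquiv.isUnit_map e]

/-- A ring isomorphism of local rings maps `𝔪` to `𝔪'` as ideals. [folklore] -/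
theorem map_maximalIdeal_ringEquiv [IsLocalRing R] [IsLocalRing R'] (e : R ≃+* R') :
    (maximalIdeal R).map (e : R →+* R') = maximalIdeal R' := by
  ext y
  constructor
  · intro hy
    rw [Ideal.mem_map_iff_of_surjective (e : R →+* R') e.surjective] at hy
    obtain ⟨x, hx, rfl⟩ := hy
    exact (mem_maximalIdeal_ringEquiv_iff e x).mpr hx
  · intro hy
    have : y = e (e.symm y) := (e.apply_symm_apply y).symm
    rw [this]
    exact Ideal.mem_map_of_mem _ ((mem_maximalIdeal_ringEquiv_iff e _).mp (by rwa [e.apply_symm_apply]))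

/-- … and `𝔪²` membership is preserved. [folklore] -/
theorem mem_maximalIdeal_sq_ringEquiv_iff [IsLocalRing R] [IsLocalRing R'] (e : R ≃+* R') (x : R) :
    e x ∈ maximalIdeal R' ^ 2 ↔ x ∈ maximalIdeal R ^ 2 := by
  rw [← map_maximalIdeal_ringEquiv e, ← Ideal.map_pow]
  constructor
  · intro h
    have h' := Ideal.mem_map_of_mem (e.symm : R' →+* R) h
    rw [Ideal.map_map] at h'
    have hcomp : (e.symm : R' →+* R).comp (e : R →+* R') = RingHom.id R := by
      ext z; simp
    rw [hcomp, Ideal.map_id] at h'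
    simpa using h'
  · exact fun h => Ideal.mem_map_of_mem _ h

/-- **`LooseCleanForm` along a ring isomorphism of the local ring** compatible with the readings in `F`.
[folklore] -/
theorem LooseCleanForm.of_ringEquiv [IsLocalRing R] [IsLocalRing R'] (e : R ≃+* R') {f : R →+* F}
    {f' : R' →+* F} (hf : ∀ x, f' (e x) = f x) {X : F} (h : LooseCleanForm p f X) : LooseCleanForm p f' X := by
  rcases h with ⟨d, m, hmd, t, a, u, hu, hspan, hdim, hm, ha, hX⟩ | ⟨u, hu, hX, hc⟩ | ⟨s, c, hX, h1, h2⟩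
  · refine Or.inl ⟨d, m, hmd, fun i => e (t i), a, e u, (MulEquiv.isUnit_map e).mpr hu, ?_, ?_, hm, ha, ?_⟩
    · have : Set.range (fun i => e (t i)) = (e : R →+* R') '' Set.range t := by
        ext y; simp [Set.mem_range, Set.mem_image]
      rw [this, ← Ideal.map_span, hspan, map_maximalIdeal_ringEquiv]
    · rw [← hdim]; exact (ringKrullDim_eq_of_ringEquiv e).symm
    · rw [hX, ← hf]; congr 1; simp [map_mul, map_prod, map_pow]
  · refine Or.inr (Or.inl ⟨e u, (MulEquiv.isUnit_map e).mpr hu, by rw [hX, hf], fun c' hc' => ?_⟩)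
    apply hc (e.symm c')
    have : e (u - e.symm c' ^ p) = e u - c' ^ p := by simp [map_sub, map_pow]
    rw [← mem_maximalIdeal_ringEquiv_iff e, this]
    exact hc'
  · refine Or.inr (Or.inr ⟨e s, e c, by rw [hX, hf], ?_, ?_⟩)
    · have : e s - e c ^ p = e (s - c ^ p) := by simp [map_sub, map_pow]
      rw [this, mem_maximalIdeal_ringEquiv_iff]; exact h1
    · have : e s - e c ^ p = e (s - c ^ p) := by simp [map_sub, map_pow]
      rw [this, mem_maximalIdeal_sq_ringEquiv_iff]; exact h2

/-- **`CleanRegAt` along a ring isomorphism of the local ring** compatible with the readings in `F`. [folklore] -/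
theorem CleanRegAt.of_ringEquiv (e : R ≃+* R') {f : R →+* F} {f' : R' →+* F} (hf : ∀ x, f' (e x) = f x) {g₀ : F}
    (h : CleanRegAt p f g₀) : CleanRegAt p f' g₀ := by
  obtain ⟨hreg, c, hc, hform⟩ := h
  haveI : IsRegularLocalRing R' := IsRegularLocalRing.of_ringEquiv e
  exact ⟨this, c, hc, hform.of_ringEquiv e hf⟩

/-- `CleanRegAt` only depends on the reading map as a function. [folklore] -/
theorem CleanRegAt.congr_hom {f f' : R →+* F} (hf : ∀ x, f' x = f x) {g₀ : F} (h : CleanRegAt p f g₀) :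
    CleanRegAt p f' g₀ :=
  h.of_ringEquiv (RingEquiv.refl R) (fun x => hf x)

end RingEquiv

/-! ## Along maps of the target field -/

section Target

variable {R F F' : Type*} [CommRing R] [CommRing F] [CommRing F']

/-- `LooseCleanForm` pushes forward along any ring map of the target. [folklore] -/
theorem LooseCleanForm.map [IsLocalRing R] {f : R →+* F} (ι : F →+* F') {X : F} (h : LooseCleanForm p f X) :
    LooseCleanForm p (ι.comp f) (ι X) := by
  rcases h with ⟨d, m, hmd, t, a, u, hu, hspan, hdim, hm, ha, hX⟩ | ⟨u, hu, hX, hc⟩ | ⟨s, c, hX, h1, h2⟩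
  · exact Or.inl ⟨d, m, hmd, t, a, u, hu, hspan, hdim, hm, ha, by rw [hX]; rfl⟩
  · exact Or.inr (Or.inl ⟨u, hu, by rw [hX]; rfl, hc⟩)
  · exact Or.inr (Or.inr ⟨s, c, by rw [hX]; rfl, h1, h2⟩)

/-- … and pulls back along an injective one. [folklore] -/
theorem LooseCleanForm.of_map [IsLocalRing R] {f : R →+* F} (ι : F →+* F') (hι : Function.Injective ι) {X : F}
    (h : LooseCleanForm p (ι.comp f) (ι X)) : LooseCleanForm p f X := by
  rcases h with ⟨d, m, hmd, t, a, u, hu, hspan, hdim, hm, ha, hX⟩ | ⟨u, hu, hX, hc⟩ | ⟨s, c, hX, h1, h2⟩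
  · exact Or.inl ⟨d, m, hmd, t, a, u, hu, hspan, hdim, hm, ha, hι hX⟩
  · exact Or.inr (Or.inl ⟨u, hu, hι hX, hc⟩)
  · exact Or.inr (Or.inr ⟨s, c, hι hX, h1, h2⟩)

/-- **`CleanRegAt` pushes forward along an injective ring map of the target** (the representative `∑ cⱼ^p g₀^j` is
carried along; injectivity keeps it non-trivial). [folklore] -/
theorem CleanRegAt.map {f : R →+* F} (ι : F →+* F') (hι : Function.Injective ι) {g₀ : F} (h : CleanRegAt p f g₀) :
    CleanRegAt p (ι.comp f) (ι g₀) := by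
  obtain ⟨hreg, c, ⟨j, hj, hcj⟩, hform⟩ := h
  refine ⟨hreg, fun i => ι (c i), ⟨j, hj, fun h0 => hcj (hι (by rw [map_zero]; exact h0))⟩, ?_⟩
  have hsum : (∑ i : Fin p, ι (c i) ^ p * ι g₀ ^ (i : ℕ)) = ι (∑ i : Fin p, c i ^ p * g₀ ^ (i : ℕ)) := by
    simp [map_sum, map_mul, map_pow]
  rw [hsum]
  exact hform.map ι

/-- **`CleanRegAt` pulls back along a ring isomorphism of the target.** [folklore] -/
theorem CleanRegAt.of_map_ringEquiv {f : R →+* F} (ι : F ≃+* F') {g₀ : F}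
    (h : CleanRegAt p ((ι : F →+* F').comp f) (ι g₀)) : CleanRegAt p f g₀ := by
  obtain ⟨hreg, c', ⟨j, hj, hcj⟩, hform⟩ := h
  refine ⟨hreg, fun i => ι.symm (c' i), ⟨j, hj, fun h0 => hcj (by simpa using congrArg ι h0)⟩, ?_⟩
  refine LooseCleanForm.of_map (ι : F →+* F') ι.injective ?_
  have hsum : (ι : F →+* F') (∑ i : Fin p, ι.symm (c' i) ^ p * g₀ ^ (i : ℕ)) =
      ∑ i : Fin p, c' i ^ p * ι g₀ ^ (i : ℕ) := by
    simp [map_sum, map_mul, map_pow]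
  rw [hsum]
  exact hform

/-- `CleanRegAt` is invariant under ring isomorphisms of the target. [folklore] -/
theorem cleanRegAt_map_ringEquiv_iff {f : R →+* F} (ι : F ≃+* F') {g₀ : F} :
    CleanRegAt p ((ι : F →+* F').comp f) (ι g₀) ↔ CleanRegAt p f g₀ :=
  ⟨CleanRegAt.of_map_ringEquiv ι, fun h => h.map (ι : F →+* F') ι.injective⟩

end Target

/-! ## Along morphisms of integral schemes -/

section Schemes

variable {X Y : Scheme.{0}} [IsIntegral X] [IsIntegral Y] (f : X ⟶ Y) [IsDominant f]

/-- **Clean-regularity ascends along a local isomorphism**: if `f : X → Y` is dominant and its stalk map at `x` is an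
isomorphism, clean-regularity of the line of `G` at `f x` gives clean-regularity of the line of `f^♯ G` at `x`.
[folklore] -/
theorem CleanRegAt.functionFieldMap_of_isIso_stalkMap (x : X) [IsIso (f.stalkMap x)] {G : Y.functionField}
    (h : CleanRegAt p (algebraMap (Y.presheaf.stalk (f x)) Y.functionField) G) :
    CleanRegAt p (algebraMap (X.presheaf.stalk x) X.functionField) (RatFn.functionFieldMap f G) := by
  let e : Y.presheaf.stalk (f x) ≃+* X.presheaf.stalk x := (asIso (f.stalkMap x)).commRingCatIsoToRingEquiv
  have h1 : CleanRegAt p ((RatFn.functionFieldMap f).comp (algebraMap (Y.presheaf.stalk (f x)) Y.functionField))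
      (RatFn.functionFieldMap f G) :=
    h.map (RatFn.functionFieldMap f) (RatFn.functionFieldMap f).injective
  refine h1.of_ringEquiv e fun t => ?_
  change algebraMap (X.presheaf.stalk x) X.functionField ((f.stalkMap x) t) =
    RatFn.functionFieldMap f (RatFn.toFunctionField (f x) t)
  rw [RatFn.functionFieldMap_toFunctionField]

/-- **… and descends when `f` is birational on function fields** (e.g. an open immersion, a blow-up, a
modification). [folklore] -/
theorem CleanRegAt.of_functionFieldMap_of_isIso_stalkMap (x : X) [IsIso (f.stalkMap x)]
    (hbij : Function.Bijective (RatFn.functionFieldMap f)) {G : Y.functionField}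
    (h : CleanRegAt p (algebraMap (X.presheaf.stalk x) X.functionField) (RatFn.functionFieldMap f G)) :
    CleanRegAt p (algebraMap (Y.presheaf.stalk (f x)) Y.functionField) G := by
  let ι : Y.functionField ≃+* X.functionField := RingEquiv.ofBijective (RatFn.functionFieldMap f) hbij
  let e : X.presheaf.stalk x ≃+* Y.presheaf.stalk (f x) := (asIso (f.stalkMap x)).commRingCatIsoToRingEquiv.symm
  refine CleanRegAt.of_map_ringEquiv ι ?_
  refine h.of_ringEquiv e fun t => ?_
  change RatFn.functionFieldMap f (RatFn.toFunctionField (f x) (e t)) = algebraMap _ _ t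
  rw [RatFn.functionFieldMap_toFunctionField]
  change RatFn.toFunctionField x ((asIso (f.stalkMap x)).commRingCatIsoToRingEquiv
    ((asIso (f.stalkMap x)).commRingCatIsoToRingEquiv.symm t)) = _
  rw [RingEquiv.apply_symm_apply]

/-- The two directions together. [folklore] -/
theorem cleanRegAt_functionFieldMap_iff_of_bijective (x : X) [IsIso (f.stalkMap x)]
    (hbij : Function.Bijective (RatFn.functionFieldMap f)) {G : Y.functionField} :
    CleanRegAt p (algebraMap (X.presheaf.stalk x) X.functionField) (RatFn.functionFieldMap f G) ↔
      CleanRegAt p (algebraMap (Y.presheaf.stalk (f x)) Y.functionField) G :=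
  ⟨CleanRegAt.of_functionFieldMap_of_isIso_stalkMap f x hbij, CleanRegAt.functionFieldMap_of_isIso_stalkMap f x⟩

end Schemes

/-! ## The two currencies of a projective model -/

section Models

variable {k K : Type} [Field k] [Field K] [Algebra k K]

/-- **`ModelCleanRegAt` (local ring inside `K`) versus `CleanRegAt` at the stalk read in `K(M)`**: they agree through
`K(M) ≅ K` (`ProjModel.funFieldIso`) and `𝒪_{M,x} ≅ M.stalkSubring x` (`ProjModel.stalkEquiv`). [folklore] -/
theorem modelCleanRegAt_iff_stalk {g₀ : K} (M : ProjModel k K) (x : M.X) :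
    ModelCleanRegAt p g₀ M x ↔
      CleanRegAt p (algebraMap (M.X.presheaf.stalk x) M.X.functionField) (M.funFieldIso.inv.hom g₀) := by
  let ι : M.X.functionField ≃+* K := M.funFieldIso.commRingCatIsoToRingEquiv
  have hιg : ι (M.funFieldIso.inv.hom g₀) = g₀ := by
    change (M.funFieldIso.inv ≫ M.funFieldIso.hom).hom g₀ = g₀
    rw [Iso.inv_hom_id]; rfl
  -- the stalk read in `K` is `stalkToK`
  have hcomp : ∀ t, ((ι : M.X.functionField →+* K).comp (algebraMap (M.X.presheaf.stalk x) M.X.functionField)) t =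
      M.stalkToK x t := fun t => rfl
  constructor
  · intro h
    -- `ModelCleanRegAt` = `CleanRegAt p (M.stalkSubring x).subtype g₀`; move to the stalk along `stalkEquiv`
    have h1 : CleanRegAt p ((ι : M.X.functionField →+* K).comp
        (algebraMap (M.X.presheaf.stalk x) M.X.functionField)) g₀ := by
      refine CleanRegAt.of_ringEquiv (M.stalkEquiv x).symm (f := (M.stalkSubring x).subtype) ?_ h
      intro z
      rw [hcomp, ProjModel.stalkToK_stalkEquiv_symm]
      rfl
    rw [← hιg] at h1
    exact CleanRegAt.of_map_ringEquiv ι h1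
  · intro h
    have h1 := h.map (ι : M.X.functionField →+* K) ι.injective
    have hιg' : (ι : M.X.functionField →+* K) (M.funFieldIso.inv.hom g₀) = g₀ := hιg
    rw [hιg'] at h1
    refine CleanRegAt.of_ringEquiv (M.stalkEquiv x) (f' := (M.stalkSubring x).subtype) ?_ h1
    intro t
    rw [hcomp]
    rfl

/-- The same with `funFieldAlgEquiv.symm`. [folklore] -/
theorem modelCleanRegAt_iff_stalk' {g₀ : K} (M : ProjModel k K) (x : M.X) :
    ModelCleanRegAt p g₀ M x ↔
      CleanRegAt p (algebraMap (M.X.presheaf.stalk x) M.X.functionField) (M.funFieldAlgEquiv.symm g₀) := by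
  rw [ProjModel.funFieldAlgEquiv_symm_apply]
  exact modelCleanRegAt_iff_stalk M x

/-- Clean-regular points have regular stalks. [folklore] -/
theorem ModelCleanRegAt.isRegularLocalRing_stalk {g₀ : K} {M : ProjModel k K} {x : M.X} (h : ModelCleanRegAt p g₀ M x) :
    IsRegularLocalRing (M.X.presheaf.stalk x) :=
  ((modelCleanRegAt_iff_stalk M x).mp h).isRegularLocalRing

end Models

end Summit.ResolutionOfSingularities.ResolutionOfSingularities.Theorems.RadicialJung.CleanModels

end
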